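import Mathlib.Topology.LocalAtTarget
import Literature.Geometry.Lorentzian.ApproximateKerrConfiguration
import Literature.Geometry.Lorentzian.KerrConvergenceProofs
import HarnessLib

/-!
# Translating a chart between two reference backgrounds; re-anchoring a configuration to chart time `0`

Bookkeeping for the consequence-form chart gauge of `KerrConvergence.lean` /
`ApproximateKerrConfiguration.lean`. Let `B'`, `B` be reference backgrounds (`ModelBackground`:
open domain `U ⊆ E4`, reference form, time function, radius function) and `u : E4` a vector such
that the translation `x ↦ x + u` maps the domain of `B'` into (onto) the domain of `B`. Then a
chart `Ψ : B.domain → 𝓢` of a spacetime `𝓢` gives the TRANSLATED chart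
`Ψ ∘ B'.translate B u _ : B'.domain → 𝓢`, and everything the decay / closeness statements measure
is transported verbatim:

* `ModelBackground.translate`, `translateHomeomorph` — the translation as a smooth map / a
  homeomorphism of the open submanifolds; its differential is the identity
  (`mfderiv_translate_apply`);
* if the reference forms correspond (`B'.bilin x = B.bilin (x + u)`), the metric deviation of the
  translated chart is the translate of the deviation (`Spacetime.deviation_comp_translate`,
  `deviationExtend_comp_translate`), hence `Cᵏ` sup norms over corresponding sets agree
  (`supCkENorm_comp_translate`);
* if moreover the time functions correspond up to the constant `s` (`B'.time x = B.time (x + u) − s`)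
  and the radius functions correspond, then slabs, truncated slabs, windows and truncated windows
  of `B'` are carried onto those of `B` at times shifted by `s` (`translate_image_timeSlab`, …), so
  `deviationCk` / `truncDeviationCk` of the translated chart at chart time `σ` are those of `Ψ` at
  `σ + s` (`deviationCk_comp_translate`, `truncDeviationCk_comp_translate`), and window charts stay
  window charts (`isWindowChart_comp_translate`).

This is the time-translation calculus of `TimeTranslateOmegaLimit.lean` (`ModelBackground.timeShift`,
one background, translation along `∂₀` of a `∂₀`-invariant domain) for two backgrounds and an
arbitrary translation vector; it is what re-anchoring a chart-time window `[τ, τ + L]` to `[0, L]`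
needs (`ApproximateKerrConfigurationReanchor.lean`: the flat chart is translated along `τ ∂₀` onto a
translated domain, the boosted Kerr charts along `τ ∂₀` with the motion re-based). Nothing here is
specific to Kerr or Minkowski. DHRT arXiv:2104.08222, §1 (slabs of a time function, `Cᵏ` closeness
in a fixed gauge); O'Neill 1983, Ch. 9, p. 236 (Poincaré motions of frames).

## Mathlib

Open subsets of a normed space as manifolds (`TopologicalSpace.Opens` charted space,
`contMDiff_subtype_val`, `ContMDiff.subtypeVal_comp_iff`), `mfderiv_comp`,
`iteratedFDeriv_comp_add_right`, `Topology.IsOpenEmbedding.restrictPreimage`,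
`Homeomorph.isOpenEmbedding`; the chart calculus on `Opens E` of `ChartCalculus.lean`
(`OpensChart.mfderiv_eq`) and `OpensChart.mfderiv_subtypeVal_apply` (`KerrConvergenceProofs.lean`).

## References

* M. Dafermos, G. Holzegel, I. Rodnianski, M. Taylor, arXiv:2104.08222, §1.
* B. O'Neill, *Semi-Riemannian Geometry*, Academic Press 1983, Ch. 9, p. 236.
-/

noncomputable section

open Set TopologicalSpace Filter Function Topology
open scoped Manifold ContDiff Topology ENNReal

universe u

namespace Literature.Geometry.Lorentzian

/-! ### The translation between two background domains -/

namespace ModelBackground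

variable (B' B : ModelBackground) (u : E4)
  (hmem : ∀ x : E4, x ∈ (B'.domain : Set E4) → x + u ∈ (B.domain : Set E4))

/-- The **translation `x ↦ x + u`** from the domain of `B'` to the domain of `B` (granted it maps
the one into the other), as a map of the open submanifolds. O'Neill 1983, Ch. 9, p. 236
(translations as Poincaré motions). [folklore] -/
def translate : B'.domain → B.domain := fun x ↦ ⟨x.1 + u, hmem x.1 x.2⟩

/-- Unfolding lemma. [folklore] -/
@[simp]
theorem translate_coe (x : B'.domain) : ((B'.translate B u hmem x : B.domain) : E4) = x.1 + u := rfl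

/-- The translation is smooth. [folklore] -/
theorem contMDiff_translate : ContMDiff 𝓘(ℝ, E4) 𝓘(ℝ, E4) ∞ (B'.translate B u hmem) := by
  rw [← ContMDiff.subtypeVal_comp_iff]
  have h : (Subtype.val ∘ B'.translate B u hmem) = fun x : B'.domain ↦ (x : E4) + u := rfl
  rw [h]
  exact contMDiff_subtype_val.add contMDiff_const

/-- The translation is continuous. [folklore] -/
theorem continuous_translate : Continuous (B'.translate B u hmem) :=
  (continuous_subtype_val.add continuous_const).subtype_mk _

/-- The translation is injective. [folklore] -/
theorem injective_translate : Injective (B'.translate B u hmem) := by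
  intro x x' h
  have h' := congrArg Subtype.val h
  simp only [translate_coe, add_left_inj] at h'
  exact Subtype.ext h'

/-- **The differential of the translation is the identity.** [folklore] -/
theorem mfderiv_translate_apply (x : B'.domain) (v : E4) :
    mfderiv 𝓘(ℝ, E4) 𝓘(ℝ, E4) (B'.translate B u hmem) x v = v := by
  have hd : MDifferentiableAt 𝓘(ℝ, E4) 𝓘(ℝ, E4) (B'.translate B u hmem) x :=
    (B'.contMDiff_translate B u hmem x).mdifferentiableAt (by simp)
  have hval : MDifferentiableAt 𝓘(ℝ, E4) 𝓘(ℝ, E4) (Subtype.val : B.domain → E4)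
      (B'.translate B u hmem x) :=
    (contMDiff_subtype_val (I := 𝓘(ℝ, E4)) (n := ∞)).mdifferentiableAt (by simp)
  -- differentiate `val ∘ translate = (· + u) ∘ val`
  have h1 := mfderiv_comp x hval hd
  have h3 : mfderiv 𝓘(ℝ, E4) 𝓘(ℝ, E4) (Subtype.val ∘ B'.translate B u hmem) x v = v := by
    rw [OpensChart.mfderiv_eq x (Subtype.val ∘ B'.translate B u hmem) (fun y : E4 ↦ y + u)
      (fun _ ↦ rfl) (differentiableAt_id.add (differentiableAt_const _)), fderiv_add_const,
      fderiv_fun_id]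
    rfl
  have e1 : mfderiv 𝓘(ℝ, E4) 𝓘(ℝ, E4) (B'.translate B u hmem) x v =
      mfderiv 𝓘(ℝ, E4) 𝓘(ℝ, E4) (Subtype.val : B.domain → E4) (B'.translate B u hmem x)
        (mfderiv 𝓘(ℝ, E4) 𝓘(ℝ, E4) (B'.translate B u hmem) x v) :=
    (OpensChart.mfderiv_subtypeVal_apply _ _).symm
  have e2 : mfderiv 𝓘(ℝ, E4) 𝓘(ℝ, E4) (Subtype.val : B.domain → E4) (B'.translate B u hmem x)
        (mfderiv 𝓘(ℝ, E4) 𝓘(ℝ, E4) (B'.translate B u hmem) x v) =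
      mfderiv 𝓘(ℝ, E4) 𝓘(ℝ, E4) (Subtype.val ∘ B'.translate B u hmem) x v :=
    (DFunLike.congr_fun h1 v).symm
  exact e1.trans (e2.trans h3)

section Onto

variable (hmem' : ∀ y : E4, y ∈ (B.domain : Set E4) → y - u ∈ (B'.domain : Set E4))

include hmem' in
/-- If the translation by `−u` maps the domain of `B` back into the domain of `B'`, the
translation is surjective. [folklore] -/
theorem surjective_translate : Surjective (B'.translate B u hmem) :=
  fun y ↦ ⟨⟨y.1 - u, hmem' y.1 y.2⟩, Subtype.ext (by simp)⟩

/-- The translation as a **homeomorphism** of the two domains (inverse: translation by `−u`).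
[folklore] -/
def translateHomeomorph : B'.domain ≃ₜ B.domain where
  toFun := B'.translate B u hmem
  invFun y := ⟨y.1 - u, hmem' y.1 y.2⟩
  left_inv x := Subtype.ext (by simp)
  right_inv y := Subtype.ext (by simp)
  continuous_toFun := B'.continuous_translate B u hmem
  continuous_invFun := (continuous_subtype_val.sub continuous_const).subtype_mk _

/-- The homeomorphism is the translation. [folklore] -/
@[simp]
theorem translateHomeomorph_coe :
    ⇑(B'.translateHomeomorph B u hmem hmem') = B'.translate B u hmem := rfl

include hmem' in
/-- The translation is an open embedding (indeed a homeomorphism). [folklore] -/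
theorem isOpenEmbedding_translate : IsOpenEmbedding (B'.translate B u hmem) :=
  (B'.translateHomeomorph B u hmem hmem').isOpenEmbedding

include hmem' in
/-- Images of preimages under the (surjective) translation. [folklore] -/
theorem image_preimage_translate (W : Set B.domain) :
    B'.translate B u hmem '' (B'.translate B u hmem ⁻¹' W) = W :=
  image_preimage_eq W (B'.surjective_translate B u hmem hmem')

/-! ### Slabs and windows correspond, at times shifted by `s` -/

variable {s : ℝ} (htime : ∀ x : E4, B'.time x = B.time (x + u) - s)
  (hrad : ∀ x : E4, B'.radius x = B.radius (x + u))

include htime in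
/-- The slab `{t' = σ}` of `B'` is the preimage of the slab `{t = σ + s}` of `B`. [folklore] -/
theorem translate_preimage_timeSlab (σ : ℝ) :
    B'.translate B u hmem ⁻¹' B.timeSlab (σ + s) = B'.timeSlab σ := by
  ext x
  simp only [mem_preimage, mem_timeSlab, translate_coe, htime x.1]
  constructor <;> intro h <;> linarith

include htime hmem' in
/-- The translation carries the slab `{t' = σ}` onto the slab `{t = σ + s}`. [folklore] -/
theorem translate_image_timeSlab (σ : ℝ) :
    B'.translate B u hmem '' B'.timeSlab σ = B.timeSlab (σ + s) := by
  rw [← B'.translate_preimage_timeSlab B u hmem htime σ, B'.image_preimage_translate B u hmem hmem']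

include htime hrad in
/-- The truncated slab `{t' = σ, r' ≤ R}` of `B'` is the preimage of `{t = σ + s, r ≤ R}`.
[folklore] -/
theorem translate_preimage_truncTimeSlab (R σ : ℝ) :
    B'.translate B u hmem ⁻¹' B.truncTimeSlab R (σ + s) = B'.truncTimeSlab R σ := by
  ext x
  simp only [mem_preimage, mem_truncTimeSlab, translate_coe, htime x.1, hrad x.1]
  constructor <;> rintro ⟨h, h'⟩ <;> exact ⟨by linarith, h'⟩

include htime hrad hmem' in
/-- The translation carries truncated slabs onto truncated slabs. [folklore] -/
theorem translate_image_truncTimeSlab (R σ : ℝ) :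
    B'.translate B u hmem '' B'.truncTimeSlab R σ = B.truncTimeSlab R (σ + s) := by
  rw [← B'.translate_preimage_truncTimeSlab B u hmem htime hrad R σ,
    B'.image_preimage_translate B u hmem hmem']

include htime in
/-- The window `{t' ∈ [τ, τ + L]}` of `B'` is the preimage of the window `{t ∈ [τ + s, τ + s + L]}`.
[folklore] -/
theorem translate_preimage_window (τ L : ℝ) :
    B'.translate B u hmem ⁻¹' B.window (τ + s) L = B'.window τ L := by
  ext x
  simp only [mem_preimage, mem_window, translate_coe, htime x.1, mem_Icc]
  constructor <;> rintro ⟨h, h'⟩ <;> exact ⟨by linarith, by linarith⟩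

include htime hmem' in
/-- The translation carries windows onto windows. [folklore] -/
theorem translate_image_window (τ L : ℝ) :
    B'.translate B u hmem '' B'.window τ L = B.window (τ + s) L := by
  rw [← B'.translate_preimage_window B u hmem htime τ L, B'.image_preimage_translate B u hmem hmem']

include htime hrad in
/-- The truncated window of `B'` is the preimage of the truncated window of `B` at shifted times.
[folklore] -/
theorem translate_preimage_truncWindow (τ L R : ℝ) :
    B'.translate B u hmem ⁻¹' B.truncWindow (τ + s) L R = B'.truncWindow τ L R := by
  ext x
  simp only [mem_preimage, mem_truncWindow, translate_coe, htime x.1, hrad x.1, mem_Icc]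
  constructor <;> rintro ⟨⟨h, h'⟩, h''⟩ <;> exact ⟨⟨by linarith, by linarith⟩, h''⟩

include htime hrad hmem' in
/-- The translation carries truncated windows onto truncated windows. [folklore] -/
theorem translate_image_truncWindow (τ L R : ℝ) :
    B'.translate B u hmem '' B'.truncWindow τ L R = B.truncWindow (τ + s) L R := by
  rw [← B'.translate_preimage_truncWindow B u hmem htime hrad τ L R,
    B'.image_preimage_translate B u hmem hmem']

end Onto

end ModelBackground

/-! ### Translated charts: deviation, `Cᵏ` norms, window charts -/

namespace Spacetime

variable (𝓢 : Spacetime.{u} 4) (B' B : ModelBackground) (u : E4)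
  (hmem : ∀ x : E4, x ∈ (B'.domain : Set E4) → x + u ∈ (B.domain : Set E4))
  (Ψ : B.domain → 𝓢.carrier)

/-- **The differential of a translated chart**: `d(Ψ ∘ T_u)_x = dΨ_{x + u}`. [folklore] -/
theorem mfderiv_comp_translate_apply (hΨ : ContMDiff 𝓘(ℝ, E4) (𝓡 4) ∞ Ψ) (x : B'.domain)
    (v : E4) :
    mfderiv 𝓘(ℝ, E4) (𝓡 4) (Ψ ∘ B'.translate B u hmem) x v =
      mfderiv 𝓘(ℝ, E4) (𝓡 4) Ψ (B'.translate B u hmem x) v := by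
  have h := DFunLike.congr_fun (mfderiv_comp x ((hΨ _).mdifferentiableAt (by simp))
    ((B'.contMDiff_translate B u hmem x).mdifferentiableAt (by simp))) v
  exact h.trans (congrArg (mfderiv 𝓘(ℝ, E4) (𝓡 4) Ψ (B'.translate B u hmem x))
    (B'.mfderiv_translate_apply B u hmem x v))

variable (hbil : ∀ x : E4, x ∈ (B'.domain : Set E4) → B'.bilin x = B.bilin (x + u))

include hbil in
/-- **The deviation of the translated chart is the translate of the deviation**, when the
reference forms correspond under the translation. DHRT arXiv:2104.08222, §1 (the deviation in a
fixed gauge). [cite: arXiv210408222, §1] -/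
theorem deviation_comp_translate (hΨ : ContMDiff 𝓘(ℝ, E4) (𝓡 4) ∞ Ψ) (x : B'.domain) :
    𝓢.deviation B' (Ψ ∘ B'.translate B u hmem) x = 𝓢.deviation B Ψ (B'.translate B u hmem x) := by
  ext v w
  rw [Spacetime.deviation_apply, Spacetime.deviation_apply,
    𝓢.mfderiv_comp_translate_apply B' B u hmem Ψ hΨ x v,
    𝓢.mfderiv_comp_translate_apply B' B u hmem Ψ hΨ x w, hbil x.1 x.2]
  rfl

variable (hmem' : ∀ y : E4, y ∈ (B.domain : Set E4) → y - u ∈ (B'.domain : Set E4))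

include hbil hmem' in
/-- The same for the zero-extended deviations, as an identity of functions on `E4` (off the
domains both sides are the junk value `0`). [folklore] -/
theorem deviationExtend_comp_translate (hΨ : ContMDiff 𝓘(ℝ, E4) (𝓡 4) ∞ Ψ) :
    𝓢.deviationExtend B' (Ψ ∘ B'.translate B u hmem) =
      fun y ↦ 𝓢.deviationExtend B Ψ (y + u) := by
  funext y
  by_cases hy : y ∈ (B'.domain : Set E4)
  · have h1 := 𝓢.deviationExtend_coe B' (Ψ ∘ B'.translate B u hmem) ⟨y, hy⟩
    have h2 := 𝓢.deviationExtend_coe B Ψ (B'.translate B u hmem ⟨y, hy⟩)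
    exact h1.trans ((𝓢.deviation_comp_translate B' B u hmem Ψ hbil hΨ ⟨y, hy⟩).trans h2.symm)
  · have hy' : y + u ∉ (B.domain : Set E4) := fun h ↦ by
      have := hmem' _ h
      rw [add_sub_cancel_right] at this
      exact hy this
    rw [𝓢.deviationExtend_of_not_mem B' _ hy, 𝓢.deviationExtend_of_not_mem B _ hy']

include hbil hmem' in
/-- **`Cᵏ` sup norms over corresponding sets agree**: the `Cᵏ` sup norm of the deviation of the
translated chart over `S ⊆ B'.domain` is that of the deviation of `Ψ` over the translate of `S`.
[folklore] -/
theorem supCkENorm_comp_translate (hΨ : ContMDiff 𝓘(ℝ, E4) (𝓡 4) ∞ Ψ) (S : Set B'.domain)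
    (k : ℕ) :
    supCkENorm (Subtype.val '' S) k (𝓢.deviationExtend B' (Ψ ∘ B'.translate B u hmem)) =
      supCkENorm (Subtype.val '' (B'.translate B u hmem '' S)) k (𝓢.deviationExtend B Ψ) := by
  rw [𝓢.deviationExtend_comp_translate B' B u hmem Ψ hbil hmem' hΨ]
  unfold supCkENorm
  refine le_antisymm (iSup₂_le fun m hm ↦ iSup₂_le fun y hy ↦ ?_)
    (iSup₂_le fun m hm ↦ iSup₂_le fun y hy ↦ ?_)
  · obtain ⟨x, hx, rfl⟩ := hy
    rw [iteratedFDeriv_comp_add_right]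
    exact le_iSup₂_of_le m hm (le_iSup₂_of_le (x.1 + u)
      ⟨B'.translate B u hmem x, ⟨x, hx, rfl⟩, rfl⟩ le_rfl)
  · obtain ⟨x', ⟨x, hx, rfl⟩, rfl⟩ := hy
    refine le_iSup₂_of_le m hm (le_iSup₂_of_le x.1 ⟨x, hx, rfl⟩ ?_)
    rw [iteratedFDeriv_comp_add_right]
    rfl

variable {s : ℝ} (htime : ∀ x : E4, B'.time x = B.time (x + u) - s)
  (hrad : ∀ x : E4, B'.radius x = B.radius (x + u))

include hbil hmem' htime in
/-- **The `Cᵏ` deviation of the translated chart on the slab `{t' = σ}` is that of `Ψ` on the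
slab `{t = σ + s}`.** DHRT arXiv:2104.08222, §1. [cite: arXiv210408222, §1] -/
theorem deviationCk_comp_translate (hΨ : ContMDiff 𝓘(ℝ, E4) (𝓡 4) ∞ Ψ) (k : ℕ) (σ : ℝ) :
    𝓢.deviationCk B' (Ψ ∘ B'.translate B u hmem) k σ = 𝓢.deviationCk B Ψ k (σ + s) := by
  unfold deviationCk
  rw [𝓢.supCkENorm_comp_translate B' B u hmem Ψ hbil hmem' hΨ,
    B'.translate_image_timeSlab B u hmem hmem' htime]

include hbil hmem' htime hrad in
/-- **The truncated `Cᵏ` deviation of the translated chart on `{t' = σ, r' ≤ R}` is that of `Ψ`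
on `{t = σ + s, r ≤ R}`.** DHRT arXiv:2104.08222, §1. [cite: arXiv210408222, §1] -/
theorem truncDeviationCk_comp_translate (hΨ : ContMDiff 𝓘(ℝ, E4) (𝓡 4) ∞ Ψ) (k : ℕ) (R σ : ℝ) :
    𝓢.truncDeviationCk B' (Ψ ∘ B'.translate B u hmem) k R σ =
      𝓢.truncDeviationCk B Ψ k R (σ + s) := by
  unfold truncDeviationCk
  rw [𝓢.supCkENorm_comp_translate B' B u hmem Ψ hbil hmem' hΨ,
    B'.translate_image_truncTimeSlab B u hmem hmem' htime hrad]

include hmem' in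
/-- The image of the preimage window under the translated chart is the image of the window.
[folklore] -/
theorem image_comp_translate_preimage (W : Set B.domain) :
    (Ψ ∘ B'.translate B u hmem) '' (B'.translate B u hmem ⁻¹' W) = Ψ '' W := by
  rw [image_comp, B'.image_preimage_translate B u hmem hmem']

include hmem' in
/-- **A translated window chart is a window chart** (for the preimage window region): smoothness
composes, the open embedding on a neighbourhood `V ⊇ W` restricts along the homeomorphic
translation to the neighbourhood `T⁻¹ V ⊇ T⁻¹ W`, and the window image is unchanged.
DHRT arXiv:2104.08222, §1. [cite: arXiv210408222, §1] -/
theorem isWindowChart_comp_translate {O : Set 𝓢.carrier} {W : Set B.domain}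
    (h : 𝓢.IsWindowChart B O W Ψ) :
    𝓢.IsWindowChart B' O (B'.translate B u hmem ⁻¹' W) (Ψ ∘ B'.translate B u hmem) where
  contMDiff := h.contMDiff.comp (B'.contMDiff_translate B u hmem)
  exists_isOpenEmbedding := by
    obtain ⟨V, hV, hWV, hΨ⟩ := h.exists_isOpenEmbedding
    refine ⟨B'.translate B u hmem ⁻¹' V, hV.preimage (B'.continuous_translate B u hmem),
      preimage_mono hWV, ?_⟩
    have hfun : (B'.translate B u hmem ⁻¹' V).restrict (Ψ ∘ B'.translate B u hmem) =
        V.restrict Ψ ∘ V.restrictPreimage (B'.translate B u hmem) := rfl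
    rw [hfun]
    exact hΨ.comp (V.restrictPreimage_isOpenEmbedding (B'.isOpenEmbedding_translate B u hmem hmem'))
  image_subset := by
    rw [𝓢.image_comp_translate_preimage B' B u hmem Ψ hmem']
    exact h.image_subset

end Spacetime


/-! ### Re-basing a boosted Kerr motion under a lab-time translation -/

section Rebase

/-- The **re-based translation part** of a Kerr motion `(Λ, c)` when lab time is re-anchored by
`τ`: `c + τ (Λ ∂₀ − ∂₀)`. With it, rest-frame coordinates of the re-based motion at the new lab
point `x` are the rest-frame coordinates of the old motion at the old lab point `x + τ ∂₀`,
shifted back by `τ` in rest-frame time (`poincareInv_rebase`). O'Neill 1983, Ch. 9, p. 236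
(composition of Poincaré motions). [folklore] -/
def rebase (Λ : lorentzGroup) (c : E4) (τ : ℝ) : E4 :=
  c + τ • ((Λ : E4 ≃L[ℝ] E4) (E4.basisVector 0) - E4.basisVector 0)

/-- **Rest-frame coordinates of the re-based motion**:
`Λ⁻¹(x − rebase Λ c τ) = Λ⁻¹(x + τ ∂₀ − c) − τ ∂₀`. [folklore] -/
theorem poincareInv_rebase (Λ : lorentzGroup) (c : E4) (τ : ℝ) (x : E4) :
    poincareInv Λ (rebase Λ c τ) x =
      poincareInv Λ c (x + τ • E4.basisVector 0) + (-τ) • E4.basisVector 0 := by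
  have h : x - (c + τ • ((Λ : E4 ≃L[ℝ] E4) (E4.basisVector 0) - E4.basisVector 0)) =
      (x + τ • E4.basisVector 0 - c) - τ • (Λ : E4 ≃L[ℝ] E4) (E4.basisVector 0) := by
    rw [smul_sub]; abel
  unfold poincareInv rebase
  rw [h, map_sub, map_smul, ContinuousLinearEquiv.symm_apply_apply, neg_smul, sub_eq_add_neg]

variable (Λ : lorentzGroup) (c : E4) (M a τ : ℝ)

/-- The re-based boosted Kerr exterior is the lab-time translate of the old one: `x` lies in it
iff `x + τ ∂₀` lies in the old one (the Kerr–Schild radius does not see rest-frame time).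
[folklore] -/
theorem mem_boostedKerrExterior_rebase_iff (x : E4) :
    x ∈ boostedKerrExterior Λ (rebase Λ c τ) M a ↔
      x + τ • E4.basisVector 0 ∈ boostedKerrExterior Λ c M a := by
  simp only [mem_boostedKerrExterior, Kerr.mem_exterior, poincareInv_rebase,
    Kerr.radius_add_time_smul_basisVector]

/-- Domain correspondence (into) for the re-based boosted Kerr background. [folklore] -/
theorem rebase_mem :
    ∀ x : E4, x ∈ ((boostedKerrBackground Λ (rebase Λ c τ) M a).domain : Set E4) →
      x + τ • E4.basisVector 0 ∈ ((boostedKerrBackground Λ c M a).domain : Set E4) :=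
  fun x hx ↦ (mem_boostedKerrExterior_rebase_iff Λ c M a τ x).1 hx

/-- Domain correspondence (onto) for the re-based boosted Kerr background. [folklore] -/
theorem rebase_mem' :
    ∀ y : E4, y ∈ ((boostedKerrBackground Λ c M a).domain : Set E4) →
      y - τ • E4.basisVector 0 ∈ ((boostedKerrBackground Λ (rebase Λ c τ) M a).domain : Set E4) :=
  fun y hy ↦ (mem_boostedKerrExterior_rebase_iff Λ c M a τ _).2 (by rwa [sub_add_cancel])

/-- The re-based boosted Kerr–Schild form at `x` is the old one at `x + τ ∂₀` (stationarity of
the Kerr–Schild components, `Kerr.bilin_add_smul_basisVector_zero`). [cite: KerrSchild1965, §2] -/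
theorem rebase_bilin :
    ∀ x : E4, x ∈ ((boostedKerrBackground Λ (rebase Λ c τ) M a).domain : Set E4) →
      (boostedKerrBackground Λ (rebase Λ c τ) M a).bilin x =
        (boostedKerrBackground Λ c M a).bilin (x + τ • E4.basisVector 0) := by
  intro x _
  ext v w
  change boostedKerrBilin Λ (rebase Λ c τ) M a x v w =
    boostedKerrBilin Λ c M a (x + τ • E4.basisVector 0) v w
  rw [boostedKerrBilin_apply, boostedKerrBilin_apply, poincareInv_rebase,
    Kerr.bilin_add_smul_basisVector_zero]

/-- The re-based rest-frame time at `x` is the old one at `x + τ ∂₀` minus `τ`. [folklore] -/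
theorem rebase_time :
    ∀ x : E4, (boostedKerrBackground Λ (rebase Λ c τ) M a).time x =
      (boostedKerrBackground Λ c M a).time (x + τ • E4.basisVector 0) - τ := by
  intro x
  change poincareInv Λ (rebase Λ c τ) x 0 = poincareInv Λ c (x + τ • E4.basisVector 0) 0 - τ
  rw [poincareInv_rebase]
  simp [sub_eq_add_neg]

/-- The re-based rest-frame radius at `x` is the old one at `x + τ ∂₀`. [folklore] -/
theorem rebase_radius :
    ∀ x : E4, (boostedKerrBackground Λ (rebase Λ c τ) M a).radius x =
      (boostedKerrBackground Λ c M a).radius (x + τ • E4.basisVector 0) := by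
  intro x
  change Kerr.radius a (poincareInv Λ (rebase Λ c τ) x) =
    Kerr.radius a (poincareInv Λ c (x + τ • E4.basisVector 0))
  rw [poincareInv_rebase, Kerr.radius_add_time_smul_basisVector]

end Rebase

/-! ### Translating the flat domain -/

section Flat

/-- The **lab-time translate** `{x | x + u ∈ U}` of an open set `U ⊆ E4` (preimage under the
translation by `u`). [folklore] -/
def translatedOpens (U : Opens E4) (u : E4) : Opens E4 :=
  ⟨(fun x : E4 ↦ x + u) ⁻¹' (U : Set E4), U.isOpen.preimage (continuous_id.add continuous_const)⟩

/-- Membership in the translated open set. [folklore] -/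
@[simp]
theorem mem_translatedOpens {U : Opens E4} {u x : E4} : x ∈ translatedOpens U u ↔ x + u ∈ U :=
  Iff.rfl

variable (U : Opens E4) (τ : ℝ)

/-- Domain correspondence (into) for the translated Minkowski background. [folklore] -/
theorem translatedOpens_mem :
    ∀ x : E4, x ∈ ((Minkowski.backgroundOn (translatedOpens U (τ • E4.basisVector 0))).domain :
      Set E4) → x + τ • E4.basisVector 0 ∈ ((Minkowski.backgroundOn U).domain : Set E4) :=
  fun _ hx ↦ hx

/-- Domain correspondence (onto) for the translated Minkowski background. [folklore] -/
theorem translatedOpens_mem' :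
    ∀ y : E4, y ∈ ((Minkowski.backgroundOn U).domain : Set E4) →
      y - τ • E4.basisVector 0 ∈ ((Minkowski.backgroundOn (translatedOpens U
        (τ • E4.basisVector 0))).domain : Set E4) := by
  intro y hy
  change y - τ • E4.basisVector 0 + τ • E4.basisVector 0 ∈ (U : Set E4)
  rwa [sub_add_cancel]

/-- The Minkowski form is translation invariant (it is constant). [folklore] -/
theorem translatedOpens_bilin :
    ∀ x : E4, x ∈ ((Minkowski.backgroundOn (translatedOpens U (τ • E4.basisVector 0))).domain :
      Set E4) → (Minkowski.backgroundOn (translatedOpens U (τ • E4.basisVector 0))).bilin x =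
        (Minkowski.backgroundOn U).bilin (x + τ • E4.basisVector 0) :=
  fun _ _ ↦ rfl

/-- Lab time of the translated background at `x` is lab time at `x + τ ∂₀` minus `τ`. [folklore] -/
theorem translatedOpens_time :
    ∀ x : E4, (Minkowski.backgroundOn (translatedOpens U (τ • E4.basisVector 0))).time x =
      (Minkowski.backgroundOn U).time (x + τ • E4.basisVector 0) - τ := by
  intro x
  change x 0 = (x + τ • E4.basisVector 0) 0 - τ
  simp

/-- The spatial radius does not see lab time. [folklore] -/
theorem translatedOpens_radius :
    ∀ x : E4, (Minkowski.backgroundOn (translatedOpens U (τ • E4.basisVector 0))).radius x =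
      (Minkowski.backgroundOn U).radius (x + τ • E4.basisVector 0) := by
  intro x
  change E4.spatialNorm x = E4.spatialNorm (x + τ • E4.basisVector 0)
  simp only [E4.spatialNorm, Kerr.spatial_add_smul_basisVector_zero]

end Flat

/-! ### Re-anchoring a configuration to chart time `0` -/

namespace ApproximateKerrConfiguration

variable {𝓢 : Spacetime.{u} 4} {O : Set 𝓢.carrier} {k : ℕ} {ε : ℝ≥0∞} {τ L R : ℝ}
  (c : ApproximateKerrConfiguration 𝓢 O k ε τ L R)

/-- The **hole chart of the re-anchored configuration**: the old chart precomposed with the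
lab-time translation by `τ ∂₀` from the re-based boosted Kerr exterior. [folklore] -/
def reanchorChart (i : Fin c.N) :
    boostedKerrExterior (c.motion i).1 (rebase (c.motion i).1 (c.motion i).2 τ) (c.mass i)
      (c.spin i) → 𝓢.carrier :=
  c.chart i ∘ (boostedKerrBackground (c.motion i).1 (rebase (c.motion i).1 (c.motion i).2 τ)
    (c.mass i) (c.spin i)).translate (boostedKerrBackground (c.motion i).1 (c.motion i).2
    (c.mass i) (c.spin i)) (τ • E4.basisVector 0)
    (rebase_mem (c.motion i).1 (c.motion i).2 (c.mass i) (c.spin i) τ)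

/-- The **flat chart of the re-anchored configuration**: the old flat chart precomposed with the
lab-time translation by `τ ∂₀` from the translated flat domain. [folklore] -/
def reanchorFlatChart : translatedOpens c.flatDomain (τ • E4.basisVector 0) → 𝓢.carrier :=
  c.flatChart ∘ (Minkowski.backgroundOn (translatedOpens c.flatDomain
    (τ • E4.basisVector 0))).translate (Minkowski.backgroundOn c.flatDomain) (τ • E4.basisVector 0)
    (translatedOpens_mem c.flatDomain τ)

/-- The images of truncated tubes under the re-anchored hole charts are the old images at shifted
times. [folklore] -/
theorem image_reanchorChart_truncWindow (i : Fin c.N) (σ L' R' : ℝ) :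
    c.reanchorChart i '' (boostedKerrBackground (c.motion i).1
        (rebase (c.motion i).1 (c.motion i).2 τ) (c.mass i) (c.spin i)).truncWindow σ L' R' =
      c.chart i '' (boostedKerrBackground (c.motion i).1 (c.motion i).2 (c.mass i)
        (c.spin i)).truncWindow (σ + τ) L' R' :=
  (image_comp (c.chart i) _ _).trans (congrArg (c.chart i '' ·)
    (ModelBackground.translate_image_truncWindow _ _ _ _
      (rebase_mem' (c.motion i).1 (c.motion i).2 (c.mass i) (c.spin i) τ)
      (rebase_time _ _ _ _ τ) (rebase_radius _ _ _ _ τ) σ L' R'))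

/-- The images of truncated slabs under the re-anchored hole charts are the old images at shifted
times. [folklore] -/
theorem image_reanchorChart_truncTimeSlab (i : Fin c.N) (R' σ : ℝ) :
    c.reanchorChart i '' (boostedKerrBackground (c.motion i).1
        (rebase (c.motion i).1 (c.motion i).2 τ) (c.mass i) (c.spin i)).truncTimeSlab R' σ =
      c.chart i '' (boostedKerrBackground (c.motion i).1 (c.motion i).2 (c.mass i)
        (c.spin i)).truncTimeSlab R' (σ + τ) :=
  (image_comp (c.chart i) _ _).trans (congrArg (c.chart i '' ·)
    (ModelBackground.translate_image_truncTimeSlab _ _ _ _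
      (rebase_mem' (c.motion i).1 (c.motion i).2 (c.mass i) (c.spin i) τ)
      (rebase_time _ _ _ _ τ) (rebase_radius _ _ _ _ τ) R' σ))

/-- The image of a flat window under the re-anchored flat chart is the old image at shifted times.
[folklore] -/
theorem image_reanchorFlatChart_window (σ L' : ℝ) :
    c.reanchorFlatChart '' (Minkowski.backgroundOn (translatedOpens c.flatDomain
        (τ • E4.basisVector 0))).window σ L' =
      c.flatChart '' (Minkowski.backgroundOn c.flatDomain).window (σ + τ) L' :=
  (image_comp c.flatChart _ _).trans (congrArg (c.flatChart '' ·)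
    (ModelBackground.translate_image_window _ _ _ _ (translatedOpens_mem' c.flatDomain τ)
      (translatedOpens_time _ τ) σ L'))

/-- The image of a flat slab under the re-anchored flat chart is the old image at shifted times.
[folklore] -/
theorem image_reanchorFlatChart_timeSlab (σ : ℝ) :
    c.reanchorFlatChart '' (Minkowski.backgroundOn (translatedOpens c.flatDomain
        (τ • E4.basisVector 0))).timeSlab σ =
      c.flatChart '' (Minkowski.backgroundOn c.flatDomain).timeSlab (σ + τ) :=
  (image_comp c.flatChart _ _).trans (congrArg (c.flatChart '' ·)
    (ModelBackground.translate_image_timeSlab _ _ _ _ (translatedOpens_mem' c.flatDomain τ)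
      (translatedOpens_time _ τ) σ))

/-- The re-anchored hole charts are window charts for the truncated tubes over `[0, L]`.
[cite: arXiv210408222, §1] -/
theorem isWindowChart_reanchorChart (i : Fin c.N) :
    𝓢.IsWindowChart (boostedKerrBackground (c.motion i).1 (rebase (c.motion i).1 (c.motion i).2 τ)
      (c.mass i) (c.spin i)) O ((boostedKerrBackground (c.motion i).1
      (rebase (c.motion i).1 (c.motion i).2 τ) (c.mass i) (c.spin i)).truncWindow 0 L R)
      (c.reanchorChart i) := by
  have h := 𝓢.isWindowChart_comp_translate
    (boostedKerrBackground (c.motion i).1 (rebase (c.motion i).1 (c.motion i).2 τ) (c.mass i)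
      (c.spin i)) (boostedKerrBackground (c.motion i).1 (c.motion i).2 (c.mass i) (c.spin i))
    (τ • E4.basisVector 0) (rebase_mem _ _ _ _ τ) (c.chart i) (rebase_mem' _ _ _ _ τ)
    (c.isWindowChart i)
  have hw := ModelBackground.translate_preimage_truncWindow
    (boostedKerrBackground (c.motion i).1 (rebase (c.motion i).1 (c.motion i).2 τ) (c.mass i)
      (c.spin i)) (boostedKerrBackground (c.motion i).1 (c.motion i).2 (c.mass i) (c.spin i))
    (τ • E4.basisVector 0) (rebase_mem _ _ _ _ τ) (rebase_time _ _ _ _ τ) (rebase_radius _ _ _ _ τ)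
    0 L R
  rw [zero_add] at hw
  rw [hw] at h
  exact h

/-- Near-zone closeness of the re-anchored hole charts on `[0, L]`. [cite: arXiv210408222, §1] -/
theorem truncDeviationCk_reanchorChart_le (i : Fin c.N) (σ : ℝ) (hσ : σ ∈ Icc 0 (0 + L)) :
    𝓢.truncDeviationCk (boostedKerrBackground (c.motion i).1
      (rebase (c.motion i).1 (c.motion i).2 τ) (c.mass i) (c.spin i)) (c.reanchorChart i) k R σ ≤ ε := by
  have h := 𝓢.truncDeviationCk_comp_translate
    (boostedKerrBackground (c.motion i).1 (rebase (c.motion i).1 (c.motion i).2 τ) (c.mass i)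
      (c.spin i)) (boostedKerrBackground (c.motion i).1 (c.motion i).2 (c.mass i) (c.spin i))
    (τ • E4.basisVector 0) (rebase_mem _ _ _ _ τ) (c.chart i) (rebase_bilin _ _ _ _ τ)
    (rebase_mem' _ _ _ _ τ) (rebase_time _ _ _ _ τ) (rebase_radius _ _ _ _ τ)
    (c.isWindowChart i).contMDiff k R σ
  rw [mem_Icc] at hσ
  exact h.trans_le (c.truncDeviationCk_le i (σ + τ) ⟨by linarith [hσ.1], by linarith [hσ.2]⟩)

/-- Separation of the re-anchored truncated tubes (their images are the old ones). [folklore] -/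
theorem pairwise_disjoint_reanchorChart :
    Pairwise (Function.onFun Disjoint fun i ↦ c.reanchorChart i ''
      (boostedKerrBackground (c.motion i).1 (rebase (c.motion i).1 (c.motion i).2 τ) (c.mass i)
        (c.spin i)).truncWindow 0 L R) := by
  intro i j hij
  change Disjoint (c.reanchorChart i '' (boostedKerrBackground (c.motion i).1
      (rebase (c.motion i).1 (c.motion i).2 τ) (c.mass i) (c.spin i)).truncWindow 0 L R)
    (c.reanchorChart j '' (boostedKerrBackground (c.motion j).1
      (rebase (c.motion j).1 (c.motion j).2 τ) (c.mass j) (c.spin j)).truncWindow 0 L R)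
  rw [c.image_reanchorChart_truncWindow i, c.image_reanchorChart_truncWindow j, zero_add]
  exact c.pairwise_disjoint hij

/-- The translated flat domain contains the window slab over `[0, L]` minus the excised tubes of
the re-based motions. [folklore] -/
theorem setOf_lt_excision_subset_translatedOpens :
    {x : E4 | x 0 ∈ Icc 0 (0 + L) ∧ ∀ i, c.excision i < Kerr.radius (c.spin i)
      (poincareInv (c.motion i).1 (rebase (c.motion i).1 (c.motion i).2 τ) x)} ⊆
      translatedOpens c.flatDomain (τ • E4.basisVector 0) := by
  rintro x ⟨hx0, hxi⟩
  change x + τ • E4.basisVector 0 ∈ (c.flatDomain : Set E4)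
  refine c.setOf_lt_excision_subset_flatDomain ⟨?_, fun i ↦ ?_⟩
  · have h0 : (x + τ • E4.basisVector 0) 0 = x 0 + τ := by simp
    rw [h0]
    rw [mem_Icc] at hx0 ⊢
    exact ⟨by linarith [hx0.1], by linarith [hx0.2]⟩
  · have h := hxi i
    rw [poincareInv_rebase, Kerr.radius_add_time_smul_basisVector] at h
    exact h

/-- The re-anchored flat chart is a window chart for the flat window over `[0, L]`.
[cite: arXiv210408222, §1] -/
theorem isWindowChart_reanchorFlatChart :
    𝓢.IsWindowChart (Minkowski.backgroundOn (translatedOpens c.flatDomain (τ • E4.basisVector 0))) O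
      ((Minkowski.backgroundOn (translatedOpens c.flatDomain (τ • E4.basisVector 0))).window 0 L)
      c.reanchorFlatChart := by
  have h := 𝓢.isWindowChart_comp_translate
    (Minkowski.backgroundOn (translatedOpens c.flatDomain (τ • E4.basisVector 0)))
    (Minkowski.backgroundOn c.flatDomain) (τ • E4.basisVector 0)
    (translatedOpens_mem c.flatDomain τ) c.flatChart (translatedOpens_mem' _ τ)
    c.isWindowChart_flat
  have hw := ModelBackground.translate_preimage_window
    (Minkowski.backgroundOn (translatedOpens c.flatDomain (τ • E4.basisVector 0)))
    (Minkowski.backgroundOn c.flatDomain) (τ • E4.basisVector 0)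
    (translatedOpens_mem c.flatDomain τ) (translatedOpens_time _ τ) 0 L
  rw [zero_add] at hw
  rw [hw] at h
  exact h

/-- Radiation-zone closeness of the re-anchored flat chart on `[0, L]`. [cite: arXiv210408222, §1] -/
theorem deviationCk_reanchorFlatChart_le (σ : ℝ) (hσ : σ ∈ Icc 0 (0 + L)) :
    𝓢.deviationCk (Minkowski.backgroundOn (translatedOpens c.flatDomain (τ • E4.basisVector 0)))
      c.reanchorFlatChart k σ ≤ ε := by
  have h := 𝓢.deviationCk_comp_translate
    (Minkowski.backgroundOn (translatedOpens c.flatDomain (τ • E4.basisVector 0)))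
    (Minkowski.backgroundOn c.flatDomain) (τ • E4.basisVector 0)
    (translatedOpens_mem c.flatDomain τ) c.flatChart (translatedOpens_bilin _ τ)
    (translatedOpens_mem' _ τ) (translatedOpens_time _ τ) c.isWindowChart_flat.contMDiff k σ
  rw [mem_Icc] at hσ
  exact h.trans_le (c.deviationCk_flat_le (σ + τ) ⟨by linarith [hσ.1], by linarith [hσ.2]⟩)

/-- The window covering clause of the re-anchored configuration (all certified sets are the old
ones: windows unchanged, slabs at `0`, `0 + L` are the old slabs at `τ`, `τ + L`). [folklore] -/
theorem diff_subset_reanchor :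
    O \ (c.reanchorFlatChart '' (Minkowski.backgroundOn (translatedOpens c.flatDomain
          (τ • E4.basisVector 0))).window 0 L ∪
        ⋃ i, c.reanchorChart i '' (boostedKerrBackground (c.motion i).1
          (rebase (c.motion i).1 (c.motion i).2 τ) (c.mass i) (c.spin i)).truncWindow 0 L R) ⊆
      𝓢.metric.causalPast 𝓢.timeOrientation
          (c.reanchorFlatChart '' (Minkowski.backgroundOn (translatedOpens c.flatDomain
              (τ • E4.basisVector 0))).timeSlab 0 ∪
            ⋃ i, c.reanchorChart i '' (boostedKerrBackground (c.motion i).1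
              (rebase (c.motion i).1 (c.motion i).2 τ) (c.mass i) (c.spin i)).truncTimeSlab R 0) ∪
        𝓢.metric.causalFuture 𝓢.timeOrientation
          (c.reanchorFlatChart '' (Minkowski.backgroundOn (translatedOpens c.flatDomain
              (τ • E4.basisVector 0))).timeSlab (0 + L) ∪
            ⋃ i, c.reanchorChart i '' (boostedKerrBackground (c.motion i).1
              (rebase (c.motion i).1 (c.motion i).2 τ) (c.mass i) (c.spin i)).truncTimeSlab R
              (0 + L)) := by
  rw [c.image_reanchorFlatChart_window, iUnion_congr fun i ↦ c.image_reanchorChart_truncWindow i 0 L R,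
    c.image_reanchorFlatChart_timeSlab, c.image_reanchorFlatChart_timeSlab,
    iUnion_congr fun i ↦ c.image_reanchorChart_truncTimeSlab i R 0,
    iUnion_congr fun i ↦ c.image_reanchorChart_truncTimeSlab i R (0 + L), zero_add τ, zero_add L,
    add_comm L τ]
  exact c.diff_subset

/-- **Re-anchoring a configuration to chart time `0`** ("each window is read in its own charts,
so the start time is a normalisation", `ApproximateKerrConfiguration.lean`, module docstring): an
`ε`-approximate `N`-Kerr configuration on the chart-time window `[τ, τ + L]` IS one on `[0, L]`,
with the same holes, parameters, Lorentz parts of the motions, excision radii and certified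
images — lab time is translated by `τ` (flat chart `Ψ₀ ∘ (· + τ ∂₀)` on the translated flat
domain) and each hole's translation part is re-based to `cᵢ + τ (Λᵢ ∂₀ − ∂₀)` (hole chart
`Ψᵢ ∘ (· + τ ∂₀)`), so that rest-frame times are shifted by `τ` as well while rest-frame radii,
the Kerr–Schild forms (stationarity) and all chart images are unchanged. DHRT arXiv:2104.08222,
§1 (slabs of a time function); Klainerman, C. R. Mécanique 353 (2025), §1.1.1.
[cite: Klainerman2025, §1.1.1] -/
def reanchor : ApproximateKerrConfiguration 𝓢 O k ε 0 L R where
  N := c.N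
  mass := c.mass
  spin := c.spin
  mass_pos := c.mass_pos
  isSubextremal := c.isSubextremal
  motion i := ((c.motion i).1, rebase (c.motion i).1 (c.motion i).2 τ)
  chart := c.reanchorChart
  isWindowChart := c.isWindowChart_reanchorChart
  truncDeviationCk_le := c.truncDeviationCk_reanchorChart_le
  pairwise_disjoint := c.pairwise_disjoint_reanchorChart
  excision := c.excision
  excision_le := c.excision_le
  flatDomain := translatedOpens c.flatDomain (τ • E4.basisVector 0)
  setOf_lt_excision_subset_flatDomain := c.setOf_lt_excision_subset_translatedOpens
  flatChart := c.reanchorFlatChart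
  isWindowChart_flat := c.isWindowChart_reanchorFlatChart
  deviationCk_flat_le := c.deviationCk_reanchorFlatChart_le
  diff_subset := c.diff_subset_reanchor

/-- Re-anchoring keeps the number of holes. [folklore] -/
@[simp]
theorem reanchor_N : c.reanchor.N = c.N := rfl

/-- Re-anchoring keeps the masses. [folklore] -/
@[simp]
theorem reanchor_mass : c.reanchor.mass = c.mass := rfl

/-- Re-anchoring keeps the spins. [folklore] -/
@[simp]
theorem reanchor_spin : c.reanchor.spin = c.spin := rfl

/-- Re-anchoring keeps the excision radii. [folklore] -/
@[simp]
theorem reanchor_excision : c.reanchor.excision = c.excision := rfl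

/-- Re-anchoring keeps the near zones (as subsets of the spacetime). [folklore] -/
theorem nearZone_reanchor (i : Fin c.N) : c.reanchor.nearZone i = c.nearZone i := by
  change c.reanchorChart i '' (boostedKerrBackground (c.motion i).1
      (rebase (c.motion i).1 (c.motion i).2 τ) (c.mass i) (c.spin i)).truncWindow 0 L R =
    c.chart i '' (boostedKerrBackground (c.motion i).1 (c.motion i).2 (c.mass i)
      (c.spin i)).truncWindow τ L R
  rw [c.image_reanchorChart_truncWindow i, zero_add]

/-- Re-anchoring keeps the radiation zone. [folklore] -/
theorem radiationZone_reanchor : c.reanchor.radiationZone = c.radiationZone := by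
  change c.reanchorFlatChart '' (Minkowski.backgroundOn (translatedOpens c.flatDomain
      (τ • E4.basisVector 0))).window 0 L =
    c.flatChart '' (Minkowski.backgroundOn c.flatDomain).window τ L
  rw [c.image_reanchorFlatChart_window, zero_add]

/-- **Re-anchoring keeps the certified window image.** [folklore] -/
theorem windowImage_reanchor : c.reanchor.windowImage = c.windowImage := by
  change c.reanchor.radiationZone ∪ (⋃ i : Fin c.N, c.reanchor.nearZone i) =
    c.radiationZone ∪ ⋃ i, c.nearZone i
  rw [c.radiationZone_reanchor, iUnion_congr c.nearZone_reanchor]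

/-- **Re-anchoring shifts the certified slabs**: the certified slab of the re-anchored
configuration at chart time `σ` is the old one at chart time `σ + τ`. [folklore] -/
theorem certifiedSlab_reanchor (σ : ℝ) : c.reanchor.certifiedSlab σ = c.certifiedSlab (σ + τ) := by
  change c.reanchorFlatChart '' (Minkowski.backgroundOn (translatedOpens c.flatDomain
      (τ • E4.basisVector 0))).timeSlab σ ∪
      (⋃ i : Fin c.N, c.reanchorChart i '' (boostedKerrBackground (c.motion i).1
        (rebase (c.motion i).1 (c.motion i).2 τ) (c.mass i) (c.spin i)).truncTimeSlab R σ) =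
    c.flatChart '' (Minkowski.backgroundOn c.flatDomain).timeSlab (σ + τ) ∪
      ⋃ i, c.chart i '' (boostedKerrBackground (c.motion i).1 (c.motion i).2 (c.mass i)
        (c.spin i)).truncTimeSlab R (σ + τ)
  rw [c.image_reanchorFlatChart_timeSlab, iUnion_congr fun i ↦ c.image_reanchorChart_truncTimeSlab i R σ]

/-- In particular the start slab of the re-anchored configuration is the old certified slab at
chart time `τ`. [folklore] -/
theorem certifiedSlab_reanchor_zero : c.reanchor.certifiedSlab 0 = c.certifiedSlab τ := by
  rw [certifiedSlab_reanchor, zero_add]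

/-- **Existence form**: a configuration on `[τ, τ + L]` yields one on `[0, L]` with the same
number of holes, the same masses and spins index by index, the same certified window image and
the certified slabs shifted by `τ` — the cast-free facts a chain of windows consumes
(`VacuumCauchyDevelopment.IsAdiabaticallyTracked`, `AdiabaticTracking.lean`).
[cite: Klainerman2025, §1.1.1] -/
theorem exists_reanchor :
    ∃ c' : ApproximateKerrConfiguration 𝓢 O k ε 0 L R, c'.N = c.N ∧
      (∀ i : Fin c'.N, ∃ j : Fin c.N, c'.mass i = c.mass j ∧ c'.spin i = c.spin j) ∧
      c'.windowImage = c.windowImage ∧ ∀ σ, c'.certifiedSlab σ = c.certifiedSlab (σ + τ) :=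
  ⟨c.reanchor, rfl, fun i ↦ ⟨i, rfl, rfl⟩, c.windowImage_reanchor, c.certifiedSlab_reanchor⟩

end ApproximateKerrConfiguration

end Literature.Geometry.Lorentzian

end
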